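import Literature.MathematicalPhysics.QuantumFieldTheory.Balaban1983to89.B11Eq127EulerLagrange
import Literature.MathematicalPhysics.QuantumFieldTheory.Balaban1983to89.B11Eq129Minimizer

/-!
# `Balaban1983to89.B11Eq101Translation` — T. Bałaban, *The variational problem and background fields in renormalization group method for lattice gauge theories*, Commun. Math. Phys. **102** (1985) 277–309 [Balaban1985Variational]: (99)–(102) p. 293 — the variational equation (99)–(100) (= (82) with (84) inserted) and its translated form (101)–(102) under `A′ = A₁ + H₁B`, «using the identity ⟨δA′, Δ₁H₁B⟩ = 0 following from the definitions of H₁», PROVED over the abstract vocabulary of `B11Eq127EulerLagrange` / `B11Eq129Minimizer` (theorem-only)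

statement-level skeleton of published theorems with citation tags; proofs where landed; nothing here is a claim about the Yang–Mills mass gap

PDF held: `paper:balaban1985-cmp102-variational-background` (journal page = PDF page + 276).  Render
`run/shared/lean/pub/pub-balaban/b2b-balaban-ref1/pages/1985-cmp102-variational-background/…-p017-x2.png` (p. 293)
READ AS AN IMAGE by this seat (lit-balaban reader/typer r08, gen 2, 2026-08-21).

CITATION HEADER (lean-in-tree rule 2026-08-18).  WHAT IS REPRODUCED: SKELETON row `B11.Eq99` ((99)–(104)) of
`HOME/lit-balaban-r08/ROWS-B11.md` — the displays (99)–(102); the arithmetic (103) is `B11Smallness.ineq103`, (104) is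
the carrier bound `B11.LGData.nMax`.  REUSED by name: `B11Eq127EulerLagrange.laplaceA` (`Δ₁ + DRD* + Q*aQ`) and
`inner_laplaceA_apply`, the constrained minimiser `B11Eq129Minimizer.hOp` (`H₁B = G₁Q*(QG₁Q*)⁻¹b`) and
`inner_delta_hOp_eq_zero`; the derivative (84) enters as the continuous linear functional `⟨·, J⟩ + ⟨·, Δ₁A′⟩ + DV` of
`B11Eq81Expansion.hasFDerivAt84` (same expression; that module is not imported here).

THE PRINT (p. 293 [PDF 17], verbatim).  «Now let us consider the variational Eq. (82). Using (84) we get the equation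
  ⟨δA′, J⟩ + ⟨δA′, Δ₁A′⟩ + ⟨δA′, (δ/δA′)V(A′)⟩ = 0. (99)
This equation has to be satisfied for all δA′ satisfying
  QδA′ = 0 (i.e. Q_jδA′ = 0 on Λ_j), RD*δA′ = 0, (100)
and we are looking for a solution A′ satisfying the conditions (75)–(77). We take the operators H₁, 𝔓 defined by the
operator Δ₁. Let us recall that 𝔓 is an orthogonal projection in a space of configurations A′ with a scalar product
defined by the operator Δ₁ + D*RD + aQ*Q, onto a subspace of A′ satisfying the conditions QA′ = 0, RD*A′ = 0. We make
the translation A′ = A₁ + H₁B. Using the identity ⟨δA′, Δ₁H₁B⟩ = 0 following from the definitions of H₁, we get the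
equations
  ⟨δA′, J⟩ + ⟨δA′, Δ₁A₁⟩ + ⟨δA′, ((δ/δA′)V)(A₁ + H₁B)⟩ = 0, (101)
  QδA′ = 0, RD*δA′ = 0, QA₁ = 0, RD*A₁ = 0. (102)»

DICTIONARY (abstract real inner-product spaces `E` (fields), `F` (block data), module `S` (range of `D*`); nothing of
the lattice is constructed).  `Δ₁ : E →ₗ[ℝ] E`; `Q`, `Qadj` (`⟨x, Q*y⟩ = ⟨Qx, y⟩`), `D`, `R`, `Dstar`, the constant `a`;
`Δ_{1,a} = Δ₁ + DRD* + Q*aQ` = `laplaceA Δ₁ D R Dstar Q Qadj a` (print writes the weight `D*RD` on p. 293 and `DRD*` in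
(45)/(129); the composite `D ∘ R ∘ D*` of `laplaceA` is meant); `G₁` with `Δ_{1,a}(G₁x) = x` ((117), [5] (3.129));
`H₁B` ↦ `hOp G₁ Qadj Kinv b` (`b = (L^{j(·)}η)⁻¹B`, `Kinv = (QG₁Q*)⁻¹`), its Landau property `RD*H₁B = 0` ((45)) is the
hypothesis `hRD`; `⟨δA′, (δ/δA′)V(·)⟩` ↦ a linear functional `DV` applied to `δA′` (the Fréchet derivative of `V` at the
point `A′ = A₁ + H₁B`, the same object in (99) and (101)).

WHAT IS CERTIFIED (kernel, sorry-free, theorem-only).  `eq99_iff`: (99)–(100) IS (82) with (84) inserted — the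
derivative `⟨·,J⟩ + ⟨·,Δ₁A′⟩ + DV` (as a continuous linear functional) vanishes on `{QδA′ = 0, RD*δA′ = 0}` iff
`∀ δA′, QδA′ = 0 → RD*δA′ = 0 → ⟨δA′,J⟩ + ⟨δA′,Δ₁A′⟩ + DV δA′ = 0`;
`inner_delta1_H1_eq_zero`: «the identity ⟨δA′, Δ₁H₁B⟩ = 0» for `QδA′ = 0`, PROVED from `Δ_{1,a}H₁B = Q*(QG₁Q*)⁻¹b ∈ range
Q*` and `RD*H₁B = 0` (so the `DRD*` and `Q*aQ` parts of `Δ_{1,a}` do not see `δA′`); **(101)** `eq101_of_eq99` (and the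
converse `eq99_of_eq101`): the translation `A′ = A₁ + H₁B` turns (99) into (101); **(102)** `eq102`: `QA₁ = 0`, `RD*A₁ = 0`
from `QA′ = b = QH₁B` ((75), (45)) and `RD*A′ = 0 = RD*H₁B` ((76), (45)).

HONEST SCOPE — what is NOT claimed.  The projection `𝔓` and (105)–(111) are not typed here (`B11Eq131Projection.proj0` is
the one-constraint `P₀`; (105)–(111) abstractly in `B11Prop6Scheme`); (103)–(104) are `B11Smallness.ineq103` / carrier;
existence of `G₁`, `(QG₁Q*)⁻¹` and the property `RD*H₁ = 0` are hypotheses ([5] Sect. D, Thm 3.12–3.13).  Nothing here is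
progress on the summit `Summit.QuantumFields`.  Unit `lit-balaban-r08` gen 2 (row `B11.Eq99` of
`HOME/lit-balaban-r08/ROWS-B11.md`, HOME = `run/shared/lean/pub/lit-balaban/`).
-/

open scoped InnerProductSpace

namespace Literature.MathematicalPhysics.QuantumFieldTheory.Balaban1983to89.B11Eq101Translation

open B11Eq127EulerLagrange (laplaceA inner_laplaceA_apply)
open B11Eq129Minimizer (hOp constraint_hOp inner_delta_hOp_eq_zero)

variable {E F : Type*} [NormedAddCommGroup E] [InnerProductSpace ℝ E] [NormedAddCommGroup F]
  [InnerProductSpace ℝ F]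
variable {S : Type*} [AddCommGroup S] [Module ℝ S]

/-- **(99)–(100)** «Using (84) we get the equation (99)»: the variational equation (82) — the derivative (84)
`δA′ ↦ ⟨δA′, J⟩ + ⟨δA′, Δ₁A′⟩ + ⟨δA′, (δ/δA′)V(A′)⟩` (the continuous linear functional `⟨·,J⟩ + ⟨·,Δ₁A′⟩ + DV`)
vanishes on the tangent space (100) `{QδA′ = 0, RD*δA′ = 0}` — written out.
[cite: Balaban1985Variational, (99)-(100) p.293] -/
theorem eq99_iff (J : E) (Δ₁ : E →L[ℝ] E) (DV : E →L[ℝ] ℝ) (A : E) (Q : E →ₗ[ℝ] F) (R : S →ₗ[ℝ] S)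
    (Dstar : E →ₗ[ℝ] S) :
    (∀ δ : E, Q δ = 0 → R (Dstar δ) = 0 → (innerSL ℝ J + innerSL ℝ (Δ₁ A) + DV) δ = 0) ↔
      ∀ δ : E, Q δ = 0 → R (Dstar δ) = 0 → ⟪δ, J⟫_ℝ + ⟪δ, Δ₁ A⟫_ℝ + DV δ = 0 := by
  simp only [add_apply, innerSL_apply_apply, real_inner_comm]

variable {Δ₁ G₁ : E →ₗ[ℝ] E} {Q : E →ₗ[ℝ] F} {Qadj : F →ₗ[ℝ] E} {Kinv : F →ₗ[ℝ] F}
variable (D : S →ₗ[ℝ] E) (R : S →ₗ[ℝ] S) (Dstar : E →ₗ[ℝ] S) (a : ℝ)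

/-- «Using the identity `⟨δA′, Δ₁H₁B⟩ = 0` following from the definitions of `H₁`»: for `QδA′ = 0`, with
`H₁B = G₁Q*(QG₁Q*)⁻¹b`, `Δ_{1,a}G₁ = 1` (`Δ_{1,a} = Δ₁ + DRD* + Q*aQ`), `⟨x, Q*y⟩ = ⟨Qx, y⟩` and `RD*H₁B = 0`:
`⟨δA′, Δ₁H₁B⟩ = ⟨δA′, Δ_{1,a}H₁B⟩ = ⟨δA′, Q*(QG₁Q*)⁻¹b⟩ = ⟨QδA′, …⟩ = 0`. [cite: Balaban1985Variational, (101) p.293] -/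
theorem inner_delta1_H1_eq_zero (hadj : ∀ (x : E) (y : F), ⟪x, Qadj y⟫_ℝ = ⟪Q x, y⟫_ℝ)
    (hΔG : ∀ x : E, laplaceA Δ₁ D R Dstar Q Qadj a (G₁ x) = x) (b : F)
    (hRD : R (Dstar (hOp G₁ Qadj Kinv b)) = 0) {δ : E} (hQ : Q δ = 0) :
    ⟪δ, Δ₁ (hOp G₁ Qadj Kinv b)⟫_ℝ = 0 := by
  rw [← inner_laplaceA_apply hadj a hRD hQ]
  exact inner_delta_hOp_eq_zero hΔG (fun x y => (hadj x y).symm) b hQ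

/-- **(101) from (99)**: after the translation `A′ = A₁ + H₁B`, equation (99) on the variations (100) reads
`⟨δA′, J⟩ + ⟨δA′, Δ₁A₁⟩ + ⟨δA′, ((δ/δA′)V)(A₁ + H₁B)⟩ = 0` (the term `⟨δA′, Δ₁H₁B⟩` drops out).
[cite: Balaban1985Variational, (101) p.293] -/
theorem eq101_of_eq99 (hadj : ∀ (x : E) (y : F), ⟪x, Qadj y⟫_ℝ = ⟪Q x, y⟫_ℝ)
    (hΔG : ∀ x : E, laplaceA Δ₁ D R Dstar Q Qadj a (G₁ x) = x) (b : F)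
    (hRD : R (Dstar (hOp G₁ Qadj Kinv b)) = 0) {J A₁ : E} {DV : E → ℝ}
    (h99 : ∀ δ : E, Q δ = 0 → R (Dstar δ) = 0 →
      ⟪δ, J⟫_ℝ + ⟪δ, Δ₁ (A₁ + hOp G₁ Qadj Kinv b)⟫_ℝ + DV δ = 0) :
    ∀ δ : E, Q δ = 0 → R (Dstar δ) = 0 → ⟪δ, J⟫_ℝ + ⟪δ, Δ₁ A₁⟫_ℝ + DV δ = 0 := by
  intro δ hQ hR
  have h := h99 δ hQ hR
  rwa [map_add, inner_add_right, inner_delta1_H1_eq_zero D R Dstar a hadj hΔG b hRD hQ, add_zero] at h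

/-- … and conversely (101) gives back (99) at `A′ = A₁ + H₁B`. [cite: Balaban1985Variational, (99)-(101) p.293] -/
theorem eq99_of_eq101 (hadj : ∀ (x : E) (y : F), ⟪x, Qadj y⟫_ℝ = ⟪Q x, y⟫_ℝ)
    (hΔG : ∀ x : E, laplaceA Δ₁ D R Dstar Q Qadj a (G₁ x) = x) (b : F)
    (hRD : R (Dstar (hOp G₁ Qadj Kinv b)) = 0) {J A₁ : E} {DV : E → ℝ}
    (h101 : ∀ δ : E, Q δ = 0 → R (Dstar δ) = 0 → ⟪δ, J⟫_ℝ + ⟪δ, Δ₁ A₁⟫_ℝ + DV δ = 0) :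
    ∀ δ : E, Q δ = 0 → R (Dstar δ) = 0 →
      ⟪δ, J⟫_ℝ + ⟪δ, Δ₁ (A₁ + hOp G₁ Qadj Kinv b)⟫_ℝ + DV δ = 0 := by
  intro δ hQ hR
  rw [map_add, inner_add_right, inner_delta1_H1_eq_zero D R Dstar a hadj hΔG b hRD hQ, add_zero]
  exact h101 δ hQ hR

/-- **(102)**: the translated field `A₁ = A′ − H₁B` satisfies `QA₁ = 0`, `RD*A₁ = 0`, because `QA′ = b` ((75):
`L^{j}ηQ_jA′ = B`) and `QH₁B = b` ((45)), `RD*A′ = 0` ((76)) and `RD*H₁B = 0` ((45)).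
[cite: Balaban1985Variational, (102) p.293] -/
theorem eq102 (hK : ∀ y : F, Q (G₁ (Qadj (Kinv y))) = y) (b : F) (hRD : R (Dstar (hOp G₁ Qadj Kinv b)) = 0)
    {A' : E} (hQA : Q A' = b) (hRA : R (Dstar A') = 0) :
    Q (A' - hOp G₁ Qadj Kinv b) = 0 ∧ R (Dstar (A' - hOp G₁ Qadj Kinv b)) = 0 := by
  refine ⟨?_, ?_⟩
  · rw [map_sub, hQA, constraint_hOp hK b, sub_self]
  · rw [map_sub, map_sub, hRA, hRD, sub_self]

end Literature.MathematicalPhysics.QuantumFieldTheory.Balaban1983to89.B11Eq101Translation
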